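import Summits.BirchSwinnertonDyer.BirchSwinnertonDyer.Theorems.ManinLocalTwoThreeStevensNaturalTes75
import Summits.BirchSwinnertonDyer.BirchSwinnertonDyer.Theorems.ManinLocalTwoThreeStevensCurveDatum
import Literature.NumberTheory.EllipticCurves.CongruentNumberCurveIsModular
import Literature.NumberTheory.Automorphic.ShimuraCurveRibetTakahashiOptimalModularityProofs
import Literature.NumberTheory.EllipticCurves.IsogenyCompProofs
import Literature.NumberTheory.EllipticCurves.IsogenyDualProofs
import HarnessLib

/-!
# C2's hypothesis type is INHABITED: a lattice-optimal `X₀(32)`-datum of a globally minimal curve exists, fact-free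
(route `ManinLocalTwoThree`, crux C2 `ManinOddAtFour` stmt-BirchSwinnertonDyer-22967; cell bsd-f2-manin, prover seat p2 gen 24;
`--supports stmt-BirchSwinnertonDyer-22967`; §1 is -an g47's E-an-g47-2 (MEMO-an §92, Sketch-an-g47.lean §C) VERBATIM, landed here for the prover lane)

The conditional closer of C2 (`Theorems.maninLocalTwoThree_maninOddAtFour_of_CDT`, p766825: CDT ⟹ `ManinOddAtFour`) and of the rung
(`Theorems.maninLocalTwoThree_maninConstantOneRung_of_CDT_of_modularity`, p767029) are `∀`-statements over lattice-optimal `X₀(N)`-data of globally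
minimal curves (`4 ∣ N` for C2).  Director (505)(W) asked whether that domain is inhabited in the kernel.  It is, at the ADDITIVE level `N = 32 = 2⁵`
(so inside C2's `4 ∣ N` world), with NO printed fact: the Literature corner `CongruentNumberCurveIsModular` PROVES
`Tunnell1983.isNewformOf_congruentNumberCurve_one : IsNewformOf (congruentNumberCurve 1) congruentCuspForm32` (`E₁ : y² = x³ − x`, conductor `32`,
`φ = η(4z)²η(8z)²`), and Literature's fact-free optimal-datum package (`exists_optimal_modularParametrizationData_of_isNewformOf'` +
`ModularParametrizationData.latticeEq_of_forall_modularDegree_le`) turns it into a lattice-optimal datum on a global minimal model of the strong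
Weil curve of the class `32a`.

* §1 `exists_latticeOptimalDatum_thirtyTwo` (E-an-g47-2, -an g47, verbatim) and the two `∃`-shapes `maninOddAtFour_domain_inhabited`
  (C2's binder block: lattice clause ∧ `2² ∣ N`) / `maninConstantOneRung_domain_inhabited`.  UNCONDITIONAL.
* §2 the unconditional satellites at `N = 32`: an optimal `X₁(32)`-datum with Manin constant `1` on the Stevens curve of `φ` exists
  (`exists_optimalGamma1Datum_one_thirtyTwo`), and the odd part of the Shimura kernel of `φ` is trivial-or-cyclic (`Λ₁(φ) ⊄ mΛ₀(φ)`, `m ≥ 3`).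
* §3 the conditional headline rows SAY SOMETHING: under {CDT, `exists_isNewformOf`} the `N = 32` datum has `|c₀| = 1`, in particular `2 ∤ c₀`
  (C2's conclusion shape) — `exists_datum_thirtyTwo_abs_maninConstant_eq_one_of_CDT_of_modularity`, `…_not_two_dvd_…`; and Carayol-at-2 checks
  out on the witness (`levelTwoPart_witness_thirtyTwo`, -an g47 verbatim).

HONEST FRAMING: §1–§2 unconditional; §3 CONDITIONAL on the two statement-only printed facts CDT (Calegari–Dimitrov–Tang 2025 Thm 1) and modularity
(`exists_isNewformOf`).  Nothing here computes `c₀(32a)` unconditionally, proves C2, Manin's conjecture or BSD; the items stay OPEN as filed.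
No definitions, no sorry.  [cite: Tunnell1983Congruent, p. 325] [cite: Knapp1993, Prop. 12.9(a)] [cite: EdixhovenManin1991, Prop. 2]
[cite: CalegariDimitrovTang2025, Thm. 1] [cite: DiamondShurman2005, Thm. 8.8.3] [cite: Carayol1986]
-/

set_option autoImplicit false
-- lint-debt: the directory name repeats the summit name (sibling precedent `ManinLocalTwoThreeStevensNaturalTes75.lean`)
set_option linter.dupNamespace false

noncomputable section

open scoped MatrixGroups ModularForm
open CongruenceSubgroup WeierstrassCurve Literature.NumberTheory.EllipticCurves Literature.NumberTheory.EllipticCurves.ModularForms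
open Literature.NumberTheory.Automorphic
open Literature.NumberTheory.EllipticCurves.Tunnell1983

namespace Summit.BirchSwinnertonDyer.BirchSwinnertonDyer.Theorems.ManinLocalTwoThree.NonVacuity

/-! ## §1 The witness at level `32` -/

/-- **E-an-g47-2 (PROVED, fact-free; -an g47 MEMO-an §92, verbatim): a lattice-optimal `X₀(32)`-datum of a global minimal curve in the isogeny
class `32a` EXISTS in the tree**, with newform `φ = η(4z)²η(8z)²` (`congruentCuspForm32`). [cite: Tunnell1983Congruent, p. 325] [cite: Knapp1993, Prop. 12.9(a)] -/
theorem exists_latticeOptimalDatum_thirtyTwo :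
    ∃ (W₀ : WeierstrassCurve ℚ) (_ : W₀.IsElliptic) (_ : W₀.IsGloballyMinimal) (D₀ : ModularParametrizationData W₀ 32),
      D₀.f = congruentCuspForm32 ∧ (congruentNumberCurve 1).IsIsogenous W₀ ∧
        ∀ z ∈ D₀.L.lattice, ∃ w ∈ periodLattice D₀.f, z = D₀.c * w := by
  haveI := isElliptic_congruentNumberCurve_one
  haveI : (congruentNumberCurve 1).IsGloballyMinimal := isGloballyMinimal_congruentNumberCurve squarefree_one
  obtain ⟨W₀, hE₀, hM₀, D₀, hf₀, hiso, hmin⟩ := exists_optimal_modularParametrizationData_of_isNewformOf' 32 (congruentNumberCurve 1)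
    conductorNorm_congruentNumberCurve_one isNewformOf_congruentNumberCurve_one
  haveI := hE₀
  exact ⟨W₀, hE₀, hM₀, D₀, hf₀, hiso, D₀.latticeEq_of_forall_modularDegree_le (by simpa [hf₀] using hmin)⟩

/-- **C2's `∀`-domain is inhabited**: there are a globally minimal elliptic `W/ℚ`, a level `N` with `2² ∣ N` and an `X₀(N)`-datum of `W` satisfying
the lattice clause — literally the binder block of `Theses.ManinLocalTwoThree.ManinOddAtFour` after its four fact hypotheses (`N = 32`).  UNCONDITIONAL.
[cite: Tunnell1983Congruent, p. 325] [cite: Knapp1993, Prop. 12.9(a)] -/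
theorem maninOddAtFour_domain_inhabited :
    ∃ (W : WeierstrassCurve ℚ) (_ : W.IsElliptic) (_ : W.IsGloballyMinimal) (N : ℕ) (_ : NeZero N) (D : ModularParametrizationData W N),
      (∀ z ∈ D.L.lattice, ∃ w ∈ periodLattice D.f, z = D.c * w) ∧ 2 ^ 2 ∣ N := by
  obtain ⟨W₀, hE₀, hM₀, D₀, -, -, hopt⟩ := exists_latticeOptimalDatum_thirtyTwo
  exact ⟨W₀, hE₀, hM₀, 32, inferInstance, D₀, hopt, by norm_num⟩

/-- **The rung's `∀`-domain (`Theses.ManinLocalTwoThree.ManinConstantOneRung`, `Rank1Residual.ManinConstant.ManinConstantOne`) is inhabited at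
level `32`** (-an g47 `nonempty_rungHypothesis_thirtyTwo`, verbatim).  UNCONDITIONAL. [cite: Tunnell1983Congruent, p. 325] -/
theorem maninConstantOneRung_domain_inhabited :
    ∃ (W₀ : WeierstrassCurve ℚ) (_ : W₀.IsElliptic) (_ : W₀.IsGloballyMinimal) (D₀ : ModularParametrizationData W₀ 32),
      ∀ z ∈ D₀.L.lattice, ∃ w ∈ periodLattice D₀.f, z = D₀.c * w := by
  obtain ⟨W₀, hE₀, hM₀, D₀, -, -, hopt⟩ := exists_latticeOptimalDatum_thirtyTwo
  exact ⟨W₀, hE₀, hM₀, D₀, hopt⟩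

/-! ## §2 Unconditional satellites at `N = 32` -/

/-- **An OPTIMAL `X₁(32)`-datum with Manin constant `1` exists** — the Stevens curve `ℂ/Λ₁(φ)` of `φ = η(4z)²η(8z)²` with its optimal datum
(p3's fact-free `StevensCurve.exists_optimal_gamma1ParametrizationData_one` on the §1 witness): the hypothesis type of the `X₁(N)`-side rows
(T-es-75, F★, F♮, `Gamma1ParametrizationData.IsOptimal`) is inhabited too.  UNCONDITIONAL. [cite: Stevens1989, §2] [cite: Tunnell1983Congruent, p. 325] -/
theorem exists_optimalGamma1Datum_one_thirtyTwo :
    ∃ (E₁ : WeierstrassCurve ℚ) (_ : E₁.IsElliptic) (D₁ : Gamma1ParametrizationData E₁ 32),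
      D₁.f = congruentCuspForm32 ∧ D₁.c = 1 ∧ D₁.IsOptimal ∧ (∀ x, x ∈ D₁.L.lattice ↔ x ∈ periodLatticeGamma1 congruentCuspForm32) ∧
        (congruentNumberCurve 1).IsIsogenous E₁ := by
  obtain ⟨W₀, hE₀, hM₀, D₀, hf₀, hiso, hopt⟩ := exists_latticeOptimalDatum_thirtyTwo
  haveI := hE₀
  obtain ⟨E₁, hE₁, D₁, hf₁, hc₁, hD₁, hL, hiso₁⟩ := StevensCurve.exists_optimal_gamma1ParametrizationData_one D₀ hopt
  haveI := hE₁
  refine ⟨E₁, hE₁, D₁, by rw [hf₁, hf₀], hc₁, hD₁, fun x ↦ by rw [hL x, hf₀], ?_⟩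
  exact hiso.trans' hiso₁.symm_of_charZero

/-- **The odd part of the Shimura kernel of `φ = η(4z)²η(8z)²` is empty**: `Λ₁(φ) ⊄ m·Λ₀(φ)` for every `m ≥ 3` (p3's fact-free
`KummerValues.not_periodLatticeGamma1_le_natCast_mul` on the §1 datum).  UNCONDITIONAL. [cite: Stevens1989, §2] -/
theorem not_periodLatticeGamma1_le_mul_thirtyTwo {m : ℕ} (hm : 3 ≤ m) :
    ¬ (∀ z ∈ periodLatticeGamma1 congruentCuspForm32, ∃ w ∈ periodLattice congruentCuspForm32, z = (m : ℂ) * w) := by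
  obtain ⟨W₀, hE₀, -, D₀, hf₀, -, -⟩ := exists_latticeOptimalDatum_thirtyTwo
  rw [← hf₀]
  exact KummerValues.not_periodLatticeGamma1_le_natCast_mul D₀ hm

/-! ## §3 The conditional headline rows at the inhabited point -/

/-- **Manin `|c₀| = 1` for the strong Weil curve of class `32a` ⟸ {CDT, modularity}** — the LEAD's conditional leaf
`Theorems.maninLocalTwoThree_maninConstantOne_of_CDT_of_modularity` INSTANTIATED at the §1 datum, which exists unconditionally.  CONDITIONAL on the
two statement-only printed facts; `c₀(32a)` is NOT computed unconditionally here. [cite: CalegariDimitrovTang2025, Thm. 1] [cite: DiamondShurman2005, Thm. 8.8.3] -/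
theorem exists_datum_thirtyTwo_abs_maninConstant_eq_one_of_CDT_of_modularity (hCDT : CalegariDimitrovTang2025_unboundedDenominators)
    (hnf : exists_isNewformOf) :
    ∃ (W₀ : WeierstrassCurve ℚ) (_ : W₀.IsElliptic) (_ : W₀.IsGloballyMinimal) (D₀ : ModularParametrizationData W₀ 32),
      D₀.f = congruentCuspForm32 ∧ (congruentNumberCurve 1).IsIsogenous W₀ ∧
        (∀ z ∈ D₀.L.lattice, ∃ w ∈ periodLattice D₀.f, z = D₀.c * w) ∧ |D₀.maninConstant| = 1 := by
  obtain ⟨W₀, hE₀, hM₀, D₀, hf₀, hiso, hopt⟩ := exists_latticeOptimalDatum_thirtyTwo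
  haveI := hE₀; haveI := hM₀
  exact ⟨W₀, hE₀, hM₀, D₀, hf₀, hiso, hopt, Theorems.maninLocalTwoThree_maninConstantOne_of_CDT_of_modularity hCDT hnf W₀ D₀ hopt⟩

/-- **C2's conclusion at the inhabited point ⟸ {CDT, modularity}**: the `N = 32` lattice-optimal datum has ODD Manin constant.  CONDITIONAL; C2 is
NOT closed by this (its `∀`-statement is closed only modulo CDT, p766825). [cite: CalegariDimitrovTang2025, Thm. 1] [cite: DiamondShurman2005, Thm. 8.8.3] -/
theorem exists_datum_thirtyTwo_not_two_dvd_maninConstant_of_CDT_of_modularity (hCDT : CalegariDimitrovTang2025_unboundedDenominators)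
    (hnf : exists_isNewformOf) :
    ∃ (W₀ : WeierstrassCurve ℚ) (_ : W₀.IsElliptic) (_ : W₀.IsGloballyMinimal) (D₀ : ModularParametrizationData W₀ 32),
      D₀.f = congruentCuspForm32 ∧ (∀ z ∈ D₀.L.lattice, ∃ w ∈ periodLattice D₀.f, z = D₀.c * w) ∧ ¬ (2 : ℤ) ∣ D₀.maninConstant := by
  obtain ⟨W₀, hE₀, hM₀, D₀, hf₀, -, hopt, h1⟩ := exists_datum_thirtyTwo_abs_maninConstant_eq_one_of_CDT_of_modularity hCDT hnf
  refine ⟨W₀, hE₀, hM₀, D₀, hf₀, hopt, fun h2 ↦ ?_⟩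
  have h2' : (2 : ℤ) ∣ |D₀.maninConstant| := (dvd_abs _ _).mpr h2
  rw [h1] at h2'
  exact absurd (Int.le_of_dvd one_pos h2') (by norm_num)

/-- **Under {CDT, modularity} EVERY lattice-optimal `X₀(32)`-datum of a globally minimal curve has odd Manin constant** (the rung at `N = 32`,
inhabited by §1).  CONDITIONAL. [cite: CalegariDimitrovTang2025, Thm. 1] [cite: DiamondShurman2005, Thm. 8.8.3] -/
theorem not_two_dvd_maninConstant_thirtyTwo_of_CDT_of_modularity (hCDT : CalegariDimitrovTang2025_unboundedDenominators)
    (hnf : exists_isNewformOf) (W₀ : WeierstrassCurve ℚ) [W₀.IsElliptic] [W₀.IsGloballyMinimal]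
    (D₀ : ModularParametrizationData W₀ 32) (hopt : ∀ z ∈ D₀.L.lattice, ∃ w ∈ periodLattice D₀.f, z = D₀.c * w) :
    ¬ (2 : ℤ) ∣ D₀.maninConstant := by
  intro h2
  have h1 := Theorems.maninLocalTwoThree_maninConstantOne_of_CDT_of_modularity hCDT hnf W₀ D₀ hopt
  have h2' : (2 : ℤ) ∣ |D₀.maninConstant| := (dvd_abs _ _).mpr h2
  rw [h1] at h2'
  exact absurd (Int.le_of_dvd one_pos h2') (by norm_num)

/-- **Carayol at `2` CHECKS OUT on the witness** (-an g47, verbatim): `v₂(32) = v₂(N(E₁))` by `conductorNorm_congruentNumberCurve_one` — a kernel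
cross-check of the tree's conductor at `2` on one type-III curve (the only use of modularity in the rung's cone is this equality per datum).
UNCONDITIONAL. [cite: Carayol1986] -/
theorem levelTwoPart_witness_thirtyTwo :
    (32 : ℕ).factorization 2 = ((congruentNumberCurve 1).conductorNorm ℤ).factorization 2 := by
  rw [conductorNorm_congruentNumberCurve_one]

end Summit.BirchSwinnertonDyer.BirchSwinnertonDyer.Theorems.ManinLocalTwoThree.NonVacuity

end
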